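import Literature.AlgebraicGeometry.ShimuraVarieties.UnitaryAuxiliaryComplexStructureInjective
import Literature.AlgebraicGeometry.ShimuraVarieties.UnitaryAuxiliarySymplecticRationalPoints
import Literature.AlgebraicGeometry.ShimuraVarieties.UnitaryAuxiliaryComplexStructureEquivariance
import Literature.AlgebraicGeometry.ShimuraVarieties.UnitaryAuxiliarySymplecticLevel
import Literature.AlgebraicGeometry.ModuliOfAbelianVarieties.SiegelRationalTransporterFinite
import Literature.Topology.Algebra.CompactMulInterAntitone
import HarnessLib

/-!
# Injectivity of `(U(H) × T₀(M)) ↪ GSp_δ` on Shimura sets at infinite level ([Deligne 1971] Prop. 1.15, the model-free core of `stub_S2inj`)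

Topic `AlgebraicGeometry/ShimuraVarieties`; namespace `Literature.AlgebraicGeometry.ShimuraVarieties.UnitaryCanonicalModel.Aux`.
Theorems only (no definition, no named fact, no instance, no `sorry`).

**`shimuraSet_mk_eq_and_classOf_eq_of_forall_siegel_mk_eq`** (cell hodgecm-mathlib, crux HDel stmt-HodgeConjecture-24835, line
F1ExtHodgeType v4.1, the MODEL-FREE CORE of `stub_S2inj`): let `K̃(N) = ũ_β⁻¹(K_δ(N)) = K_V × L_V` be a product level (`N ≠ 0`); if the
Siegel classes of `(J_x, ũ(a,t))` and `(J_{x′}, ũ(a′,t′)·ũ(u_k))`, `u_k ∈ K̃(N)`, agree at EVERY principal level `K_δ(N·(k+1)!)`, then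
`[x, aK_V] = [x′, a′K_V]` in `Sh_{K_V}(U(H), 𝔹²)(ℂ)` and `[t] = [t′]` in `T₀(M)(ℚ)∖T₀(M)(𝔸_f)/L_V`.  Ingredients, all BY NAME: the finite
rational transporter ★ `finite_setOf_conjAct_eq_and_mem` (pigeonhole: one `γ₀ ∈ GSp_δ(ℚ)` serves cofinally many levels), compact ·
shrinking levels ★ `mem_of_forall_mem_mul_of_isCompact` with ★ `iInter_principalLevelSubgroup_factorial` and ★ `continuous_auxToGspFin`
(`ũ(a,t)⁻¹γ₀ũ(a′,t′) ∈ ũ(K̃(N))`), the rational points of the embedding ★ `exists_auxToGspRat_eq_of_gspRationalToFinAdelic_eq`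
(`γ₀ = ũ(β, s)`), equivariance ★ `auxComplexStructure_ratToU21_smul_torus` and ★ `auxComplexStructure_injective` (`ρ(β)x′ = x`).
(Deligne's 1.15 proves injectivity at a FINITE level from this by a Noetherian argument on the varieties — that is the closer
`Theorems/F1ExtHodgeTypeStubS2inj.lean`, not this file.)

HC_CM is proved only modulo the 7 printed citations until rung 0 closes; this file proves no cell binder.

## References
* [Deligne1971TravauxShimura] P. Deligne, *Travaux de Shimura*, Sém. Bourbaki 389 (1971), Prop. 1.15 p. 132, 5.4.
* [Deligne1979ShimuraVarieties] P. Deligne, *Variétés de Shimura* (1979), Prop. 2.3.10, 2.1.2 (PDF pp. 32, 24).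
* [Milne2005ShimuraVarieties] J. S. Milne, *Introduction to Shimura varieties* (2005), Lemma 5.13 p. 57, §6 p. 68.
-/

set_option autoImplicit false

noncomputable section

open Matrix NumberField
open scoped TensorProduct Pointwise

namespace Literature.AlgebraicGeometry.ShimuraVarieties

namespace UnitaryCanonicalModel

namespace Aux

open Literature.AlgebraicGeometry.ModuliOfAbelianVarieties
open Literature.AlgebraicGeometry.Motives (CMType)
open Literature.Geometry.ComplexHyperbolic
open Literature.NumberTheory.Automorphic (formCongr)
open Literature.NumberTheory.Automorphic.UnitaryGroup
open Literature.NumberTheory.Automorphic.Liu2021.AppendixC (C5.OpenCompactSubgroup)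

/-! ### §3. The model-free core of `stub_S2inj` ([Deligne 1971] 1.15 at infinite level, along the factorial tower) -/



section Core

variable {L : Type} [Field L] [NumberField L] [IsCMField L] {M : Type} [Field M] [NumberField M] [IsCMField M]
  {j : L →+* M} {H : Matrix (Fin 3) (Fin 3) L} {ξ₀ ξ : M} {g : ℕ} {δ : Fin g → ℕ}
  (F : SymplecticFrame M j H ξ₀ ξ g δ) (τ : L →+* ℂ) (Φ : CMType M) (T : GL (Fin 3) ℂ)
  (hT : formCongr (starRingEnd ℂ) T (H.map τ) = BallModel.J)

/-- `N·(k+1)! ∣ N·(k'+1)!` for `k ≤ k'`. [folklore] -/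
private theorem mul_factorial_dvd (N : ℕ) {k k' : ℕ} (h : k ≤ k') : N * (k + 1).factorial ∣ N * (k' + 1).factorial :=
  mul_dvd_mul_left N (Nat.factorial_dvd_factorial (Nat.succ_le_succ h))

/-- **Model-free core of S2inj ([Deligne 1971] Prop. 1.15 at infinite level, for `(U(H) × T₀(M)) ↪ GSp_δ`).**  Let
`K̃(N) = ũ_β⁻¹(K_δ(N)) = K_V × L_V` be a product level (`N ≠ 0`).  If for EVERY `k` the Siegel classes at the principal level
`K_δ(N·(k+1)!)` of `(J_x, ũ(a,t))` and of `(J_{x′}, ũ(a′,t′)·ũ(u_k))` for SOME `u_k ∈ K̃(N)` agree, then `[x, aK_V] = [x′, a′K_V]` in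
`Sh_{K_V}(U(H), 𝔹²)(ℂ)` and `[t] = [t′]` in `T₀(M)(ℚ)\T₀(M)(𝔸_f)/L_V`.  Proof: the rational transporters `γ_k` all lie in the FINITE
set of ★ `finite_setOf_conjAct_eq_and_mem` at level `N`; one of them, `γ₀`, occurs for infinitely many `k`, hence (levels decrease
along the factorial tower) `ũ(a,t)⁻¹ γ₀ ũ(a′,t′) ∈ K_δ(N(k+1)!)·ũ(K̃(N))` for all `k`; compactness of `ũ(K̃(N))` and `⋂ₖ K_δ(N(k+1)!) = 1`
(★ `mem_of_forall_mem_mul_of_isCompact`, ★ `iInter_principalLevelSubgroup_factorial`) give `ũ(a,t)⁻¹ γ₀ ũ(a′,t′) = ũ(v)`, `v ∈ K̃(N)`;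
so `γ₀` is a rational point of the image of `ũ` (★ `exists_auxToGspRat_eq_of_gspRationalToFinAdelic_eq`): `γ₀ = ũ(β, s)`, and
equivariance (★ `auxComplexStructure_ratToU21_smul_torus`) with §2 gives `ρ(β)x′ = x`, `a⁻¹βa′ = v₁ ∈ K_V`, `t⁻¹t′ ∈ T₀(ℚ)·L_V`.
[cite: Deligne1971TravauxShimura, Prop. 1.15 p. 132 and 5.4] [cite: Milne2005ShimuraVarieties, Lemma 5.13 p. 57] -/
theorem shimuraSet_mk_eq_and_classOf_eq_of_forall_siegel_mk_eq (hΦ : IsExtAdapted τ j Φ)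
    (hJ : ∀ x : BallModel.Ball, auxComplexStructure F τ Φ T x ∈ C0pm δ) {N : ℕ} (hN : N ≠ 0)
    (KV : C5.OpenCompactSubgroup ↥(finAdelic (↥(maximalRealSubfield L)) L (IsCMField.complexConj L) 3 H))
    (LV : C5.OpenCompactSubgroup ↥(torusFinAdelic M)) (hprod : auxLevel F N = KV.1.prod LV.1)
    {x x' : BallModel.Ball} {a a' : ↥(finAdelic (↥(maximalRealSubfield L)) L (IsCMField.complexConj L) 3 H)}
    {t t' : ↥(torusFinAdelic M)}
    (h : ∀ k : ℕ, ∃ u ∈ auxLevel F N,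
      SiegelShimuraSet.mk δ (principalLevelSubgroup δ (N * (k + 1).factorial)) ⟨auxComplexStructure F τ Φ T x, hJ x⟩
          (auxToGspFin F (a, t)) =
        SiegelShimuraSet.mk δ (principalLevelSubgroup δ (N * (k + 1).factorial)) ⟨auxComplexStructure F τ Φ T x', hJ x'⟩
          (auxToGspFin F (a', t') * auxToGspFin F u)) :
    ShimuraSet.mk L H τ T hT KV.1 x a = ShimuraSet.mk L H τ T hT KV.1 x' a' ∧ classOf M LV t = classOf M LV t' := by
  classical
  set Jx : C0pm δ := ⟨auxComplexStructure F τ Φ T x, hJ x⟩ with hJxdef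
  set Jx' : C0pm δ := ⟨auxComplexStructure F τ Φ T x', hJ x'⟩ with hJx'def
  set g₁ : ↥(gspFinAdelic δ) := auxToGspFin F (a, t) with hg₁
  set g₂ : ↥(gspFinAdelic δ) := auxToGspFin F (a', t') with hg₂
  -- Step 1: rational transporters `γ k` and level corrections `u k`
  have step1 : ∀ k : ℕ, ∃ γ : ↥(gspRational δ), ∃ u ∈ auxLevel F N, conjAct δ (gspRationalToReal δ γ) Jx' = Jx ∧
      g₁⁻¹ * (gspRationalToFinAdelic δ γ * (g₂ * auxToGspFin F u)) ∈ principalLevelSubgroup δ (N * (k + 1).factorial) := by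
    intro k
    obtain ⟨u, hu, hk⟩ := h k
    obtain ⟨γ, hγJ, hq⟩ := (SiegelShimuraSet.mk_eq_mk_iff δ _ Jx Jx' g₁ (g₂ * auxToGspFin F u)).1 hk
    refine ⟨γ, u, hu, hγJ, ?_⟩
    rw [MulAction.Quotient.smul_mk, QuotientGroup.eq] at hq
    have := inv_mem hq
    rwa [_root_.mul_inv_rev, inv_inv] at this
  choose γ u hu hγJ hmem using step1
  -- Step 2: the `γ k` lie in a finite set; pigeonhole
  set S := {γ' : ↥(gspRational δ) | conjAct δ (gspRationalToReal δ γ') Jx' = Jx ∧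
      (g₁⁻¹ * (gspRationalToFinAdelic δ γ' * g₂) : ↥(gspFinAdelic δ)) ∈ principalLevelSubgroup δ N} with hSdef
  have hfin : S.Finite := finite_setOf_conjAct_eq_and_mem N Jx Jx' g₁ g₂
  have hγS : ∀ k, γ k ∈ S := by
    intro k
    refine ⟨hγJ k, ?_⟩
    have h1 : g₁⁻¹ * (gspRationalToFinAdelic δ (γ k) * (g₂ * auxToGspFin F (u k))) ∈ principalLevelSubgroup δ N :=
      principalLevelSubgroup_anti δ (dvd_mul_right N _) (hmem k)
    have h2 : auxToGspFin F (u k) ∈ principalLevelSubgroup δ N := (mem_auxLevel_iff F N _).1 (hu k)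
    have h3 := mul_mem h1 (inv_mem h2)
    have heq : g₁⁻¹ * (gspRationalToFinAdelic δ (γ k) * (g₂ * auxToGspFin F (u k))) * (auxToGspFin F (u k))⁻¹ =
        g₁⁻¹ * (gspRationalToFinAdelic δ (γ k) * g₂) := by group
    rw [heq] at h3
    exact h3
  haveI : Finite S := hfin.to_subtype
  obtain ⟨γS, hγSinf⟩ := Finite.exists_infinite_fiber (fun k : ℕ => (⟨γ k, hγS k⟩ : S))
  set γ₀ : ↥(gspRational δ) := γS.1 with hγ₀def
  have hinf : Set.Infinite {k : ℕ | γ k = γ₀} := by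
    have : Set.Infinite ((fun k : ℕ => (⟨γ k, hγS k⟩ : S)) ⁻¹' {γS}) := Set.infinite_coe_iff.1 hγSinf
    refine this.mono fun k hk => ?_
    have hk' : (⟨γ k, hγS k⟩ : S) = γS := hk
    exact congrArg Subtype.val hk'
  obtain ⟨k₀, hk₀⟩ : ∃ k, γ k = γ₀ := by
    obtain ⟨k, hk, -⟩ := hinf.exists_gt 0
    exact ⟨k, hk⟩
  have hγ₀J : conjAct δ (gspRationalToReal δ γ₀) Jx' = Jx := by rw [← hk₀]; exact hγJ k₀
  -- Step 3: `c = g₁⁻¹ γ₀ g₂` satisfies `c⁻¹ ∈ ũ(K̃(N)) · K_δ(N(k+1)!)` for all `k`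
  set c : ↥(gspFinAdelic δ) := g₁⁻¹ * (gspRationalToFinAdelic δ γ₀ * g₂) with hcdef
  set C : Set ↥(gspFinAdelic δ) := (auxToGspFin F) '' (auxLevel F N :
    Set (↥(finAdelic (↥(maximalRealSubfield L)) L (IsCMField.complexConj L) 3 H) × ↥(torusFinAdelic M))) with hCdef
  have hCcpt : IsCompact C := by
    have hK : IsCompact (auxLevel F N :
        Set (↥(finAdelic (↥(maximalRealSubfield L)) L (IsCMField.complexConj L) 3 H) × ↥(torusFinAdelic M))) := by
      rw [hprod, Subgroup.coe_prod]
      exact KV.2.2.prod LV.2.2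
    exact hK.image (continuous_auxToGspFin F)
  set U : ℕ → Set ↥(gspFinAdelic δ) := fun k => (principalLevelSubgroup δ (N * (k + 1).factorial) : Set ↥(gspFinAdelic δ))
    with hUdef
  have hUclosed : ∀ k, IsClosed (U k) := fun k =>
    isClosed_principalLevelSubgroup δ (mul_ne_zero hN (Nat.factorial_ne_zero _))
  have hUanti : Antitone U := by
    intro k k' hkk' y hy
    exact principalLevelSubgroup_anti δ (mul_factorial_dvd N hkk') hy
  have hUone : (⋂ k, U k) = {1} := iInter_principalLevelSubgroup_factorial δ N
  have hcmem : ∀ k, c⁻¹ ∈ C * U k := by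
    intro k
    obtain ⟨k', hk'mem, hkk'⟩ := hinf.exists_gt k
    have hk' : γ k' = γ₀ := hk'mem
    have hmem' : c * auxToGspFin F (u k') ∈ principalLevelSubgroup δ (N * (k + 1).factorial) := by
      have := principalLevelSubgroup_anti δ (mul_factorial_dvd N hkk'.le) (hmem k')
      rw [hk'] at this
      have heq : g₁⁻¹ * (gspRationalToFinAdelic δ γ₀ * (g₂ * auxToGspFin F (u k'))) = c * auxToGspFin F (u k') := by
        rw [hcdef]; group
      rw [heq] at this
      exact this
    refine Set.mem_mul.2 ⟨auxToGspFin F (u k'), ⟨u k', hu k', rfl⟩, (c * auxToGspFin F (u k'))⁻¹, inv_mem hmem', ?_⟩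
    group
  have hcC : c⁻¹ ∈ C :=
    Literature.Topology.Algebra.mem_of_forall_mem_mul_of_isCompact hCcpt hUclosed hUanti hUone hcmem
  obtain ⟨v₀, hv₀, hv₀c⟩ := hcC
  -- `c = ũ(v)` with `v = v₀⁻¹ ∈ K̃(N) = K_V × L_V`
  obtain ⟨v, hv, hcv⟩ : ∃ v ∈ auxLevel F N, c = auxToGspFin F v :=
    ⟨v₀⁻¹, inv_mem hv₀, by rw [map_inv, hv₀c, inv_inv]⟩
  have hvKL : v.1 ∈ KV.1 ∧ v.2 ∈ LV.1 := by
    have : v ∈ KV.1.prod LV.1 := hprod ▸ hv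
    exact Subgroup.mem_prod.1 this
  -- Step 4: `γ₀` is a rational point of the image of `ũ`
  have hγ₀f : gspRationalToFinAdelic δ γ₀ = auxToGspFin F ((a, t) * v * (a', t')⁻¹) := by
    rw [map_mul, map_mul, map_inv, ← hcv, hcdef]
    change gspRationalToFinAdelic δ γ₀ = g₁ * (g₁⁻¹ * (gspRationalToFinAdelic δ γ₀ * g₂)) * g₂⁻¹
    group
  have hpt : ((a, t) * v * (a', t')⁻¹ :
      ↥(finAdelic (↥(maximalRealSubfield L)) L (IsCMField.complexConj L) 3 H) × ↥(torusFinAdelic M)) =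
      (a * v.1 * a'⁻¹, t * v.2 * t'⁻¹) := rfl
  rw [hpt] at hγ₀f
  obtain ⟨β, s, hβ, hs, hβs⟩ := exists_auxToGspRat_eq_of_gspRationalToFinAdelic_eq F hγ₀f
  -- Step 5: `ρ(β) • x' = x`
  have hx : ratToU21 L H τ T hT β • x' = x := by
    apply auxComplexStructure_injective F τ Φ T hΦ
    rw [auxComplexStructure_ratToU21_smul_torus F τ Φ T hT β s x', hβs]
    have := congrArg Subtype.val hγ₀J
    simpa only [coe_conjAct] using this
  refine ⟨?_, ?_⟩
  · -- Step 6: the unitary classes agree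
    refine (ShimuraSet.mk_eq_mk_iff L H τ T hT KV.1 x x' a a').2 ⟨β, hx, ?_⟩
    rw [hβ]
    have heq : a⁻¹ * (a * v.1 * a'⁻¹ * a') = v.1 := by group
    rw [heq]
    exact hvKL.1
  · -- Step 7: the torus classes agree (`T₀(ℚ)` and `L_V` die in the class group)
    have hs' : toTorusFinAdelic M s * t' = t * v.2 := eq_mul_inv_iff_mul_eq.1 hs
    have ht' : t' = (toTorusFinAdelic M s)⁻¹ * (t * v.2) := eq_inv_mul_iff_mul_eq.2 hs'
    rw [classOf, QuotientGroup.mk'_apply, QuotientGroup.mk'_apply, QuotientGroup.eq, ht', mul_left_comm,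
      inv_mul_cancel_left]
    exact Subgroup.mul_mem_sup (inv_mem ⟨s, rfl⟩) hvKL.2

end Core

end Aux

end UnitaryCanonicalModel

end Literature.AlgebraicGeometry.ShimuraVarieties

end
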